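import Literature.MathematicalPhysics.QuantumFieldTheory.Balaban1983to89.Node00.TStepOfRecord

/-!
# NODE 00 — THE T-STEP CONSERVES CLASS WEIGHTS FIBRE BY FIBRE: under the unity law of the step weights, the level-`k+1` pieces
# `χ_{k+1}(s′)·(†)(s′)` of the sequences `s′` EXTENDING a fixed `s` integrate — against any bounded test function of the coarse
# field — to the level-`k` piece `χ_k(s)·T(s)` against the test function read through the averaging (the per-`init`-fibre form of
# `TStepOfRecord.isRT_sum_texpASucc`)

Cell `pub-ymgap`, YM-PLAN Track A (HUMAN RULING D-0062); author seat `pub-ymgap-dag-n20-d` (g37, the N20 lineage), on NODE 00's T-side objects of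
def-T's `Node00/TStepOfRecord` (FILE 1 of DEFINER ₇b/₉): `texpASucc`, `IsStepUnity`, `integral_transport_piece`, `tstepOfRecord`.  [III] = [Balaban1988Convergent].

WHY.  `TStepOfRecord.isRT_sum_texpASucc` proves, from the DISPLAYED unity law `IsStepUnity`, that the T-step is a renormalization transformation at the level of the
ASSEMBLED densities: `∫ (Σ_{s′} χ_{k+1}(s′)·(†)(s′)) · f = ∫ (Σ_s χ_k(s)·T(s)) · (f ∘ avg)`.  Its proof goes fibre by fibre over `init` (its `step2`: `Seq.sum_seq_succ_fiber`
and `hunit s U`).  This file records the PER-FIBRE statement, which is what a class of sequences decided at level `k` needs: for every `s`,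
`Σ_{s′ : s′.init = s} ∫ χ_{k+1}(s′)(V)·(†)(s′)(V)·f(V) dV = ∫ χ_k(s)(U)·T(s)(U)·f(Ū) dU` (§1, generic: ★ `sum_fiber_integral_chi_texpASucc_mul`; `f ≡ 1`:
★ `sum_fiber_integral_chi_texpASucc` — THE T-STEP CONSERVES THE CLASS WEIGHT OF EVERY `init`-FIBRE), and its instance at the T-step of record (§2, ★★
`sum_fiber_integral_chi_tstepOfRecord_mul ∕ sum_fiber_integral_chi_tstepOfRecord`, `k < K`).  CONSUMER: the N20 lineage's tower sockets
(`Summit…BlocksFreshTowerFaces`, hypotheses hTA ∕ hTB: CLASS-WISE TELESCOPING of the (2.18) class weights `Σ_{s′.init = π} w_{m+1}(s′) = w_m(π)`) — this file is the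
T-HALF of that law (the pre-𝐑 family); the 𝐑-half (the slot operation of record at the tuple's selector) is NOT here.

WHAT IS PROVED (kernel bookkeeping; def-T's `integral_transport_piece` ∕ `integrable_graph_piece` ∕ `integrable_transport_piece` + the unity law on ONE fibre).
* §1 (generic `P, G, D, avg`): `sum_fiber_integral_chi_texpASucc_mul`, `sum_fiber_integral_chi_texpASucc`.
* §2 (of record, `G = SU(N)`, `avOfRecord`, `chiSeqOfRecord`, `tstepOfRecord`, `k < p.K`): `sum_fiber_integral_chi_tstepOfRecord_mul`, `sum_fiber_integral_chi_tstepOfRecord`.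

HONEST FRAMING.  Nothing of Bałaban's is asserted: the unity law `IsStepUnity`, the integrability of the level-`k` piece and the measurability ∕ boundedness of the step
weights and front factors are HYPOTHESES, displayed exactly as in `isRT_sum_texpASucc` ∕ `isRT_tstepOfRecord`; no estimate; the 𝐑-step is not touched; no
`Provisos` inhabitant claimed; counts UNMOVED (typed 28∕28 · discharged 8∕27); one finite four-torus programme at fixed `ε` — NOT ℝ⁴ ∕ OS ∕ mass gap ∕ Clay.
No `def`, no `sorry`, no `axiom`, no `instance`, no `notation`.
-/

noncomputable section

open MeasureTheory
open scoped BigOperators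

namespace Literature.MathematicalPhysics.QuantumFieldTheory.Balaban1983to89.Node00

open T4Continuum B14.Eq218Concrete T4AveragingDisintegration T4FiniteEpsInhabited

/-! ## §1 Generic: one `init`-fibre of the T-step against a bounded test function of the coarse field -/

section Generic

variable {P : Params} {G : Type*} [GaugeGroup G] [MeasurableSpace G] [HaarData G] [StandardBorelSpace G]
variable {α : Type*} [Finite α] {D : ℕ → Set (Set α)} {k : ℕ}
variable {avg : GaugeField P k G → GaugeField P (k + 1) G}

open scoped Classical in
/-- ★ **THE T-STEP ON ONE `init`-FIBRE, AGAINST A TEST FUNCTION.**  Under the unity law `IsStepUnity avg χk χk1 w`, for a measurable averaging with `HaarAC`, a fixed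
level-`k` sequence `s` with integrable piece `χ_k(s)·T(s)`, bounded jointly measurable weights, bounded measurable new front factors, and a bounded measurable test
function `f` of the coarse field:
`Σ_{s′ : s′.init = s} ∫ χ_{k+1}(s′)(V)·texpASucc(s′)(V)·f(V) dV = ∫ χ_k(s)(U)·T(s)(U)·f(avg U) dU`
(each transported piece by `integral_transport_piece`; then the unity law at `(s, U)`).  The per-fibre form of `isRT_sum_texpASucc`.
[cite: Balaban1988Convergent, (3.1) p.264, (3.25) p.270] -/
theorem sum_fiber_integral_chi_texpASucc_mul (havg : Measurable avg) (hac : HaarAC avg) (χk T : Seq D k → Density P k G)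
    (χk1 : Seq D (k + 1) → Density P (k + 1) G) (w : Seq D (k + 1) → GaugeField P k G → GaugeField P (k + 1) G → ℝ)
    (s : Seq D k) (hT : Integrable (fun U => χk s U * T s U) (fieldMeasure P k G))
    (hw : ∀ s', Measurable (fun z : GaugeField P (k + 1) G × GaugeField P k G => w s' z.2 z.1))
    (hwb : ∀ s' U V', |w s' U V'| ≤ 1) (hχ : ∀ s', Measurable (χk1 s')) (hχb : ∀ s' V', |χk1 s' V'| ≤ 1)
    (hunit : IsStepUnity avg χk χk1 w) {f : GaugeField P (k + 1) G → ℝ} (hf : Measurable f) (hfC : ∃ C, ∀ V, |f V| ≤ C) :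
    ∑ s' ∈ Finset.univ.filter (fun s' : Seq D (k + 1) => s'.init = s),
        ∫ V, χk1 s' V * texpASucc avg χk T w s' V * f V ∂(fieldMeasure P (k + 1) G)
      = ∫ U, χk s U * T s U * f (avg U) ∂(fieldMeasure P k G) := by
  classical
  obtain ⟨C, hC⟩ := hfC
  have hb : ∀ s', Measurable
      (fun z : GaugeField P (k + 1) G × GaugeField P k G => w s' z.2 z.1 * (χk1 s' z.1 * f z.1)) :=
    fun s' => (hw s').mul (((hχ s').comp measurable_fst).mul (hf.comp measurable_fst))
  have hbC : ∀ s' (z : GaugeField P (k + 1) G × GaugeField P k G), ‖w s' z.2 z.1 * (χk1 s' z.1 * f z.1)‖ ≤ C := by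
    intro s' z
    rw [Real.norm_eq_abs, abs_mul, abs_mul]
    calc |w s' z.2 z.1| * (|χk1 s' z.1| * |f z.1|) ≤ 1 * (1 * C) :=
          mul_le_mul (hwb _ _ _) (mul_le_mul (hχb _ _) (hC _) (abs_nonneg _) zero_le_one)
            (mul_nonneg (abs_nonneg _) (abs_nonneg _)) zero_le_one
      _ = C := by ring
  -- every sequence of the fibre has `init = s`, so its old piece is the integrable `χ_k(s)·T(s)`
  have hTs : ∀ s' ∈ Finset.univ.filter (fun s' : Seq D (k + 1) => s'.init = s),
      Integrable (fun U => χk s'.init U * T s'.init U) (fieldMeasure P k G) := by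
    intro s' hs'
    rw [(Finset.mem_filter.1 hs').2]
    exact hT
  have e : ∀ s' V, χk1 s' V * texpASucc avg χk T w s' V * f V =
      (avgDensity avg V : ℝ) * ∫ U, (χk s'.init U * T s'.init U) * (w s' U V * (χk1 s' V * f V)) ∂(avgKernel avg V) := by
    intro s' V
    have : ∫ U, (χk s'.init U * T s'.init U) * (w s' U V * (χk1 s' V * f V)) ∂(avgKernel avg V)
        = (∫ U, w s' U V * (χk s'.init U * T s'.init U) ∂(avgKernel avg V)) * (χk1 s' V * f V) := by
      rw [← integral_mul_const]
      refine integral_congr_ae (ae_of_all _ fun U => ?_)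
      ring
    rw [this, texpASucc_apply]
    ring
  calc ∑ s' ∈ Finset.univ.filter (fun s' : Seq D (k + 1) => s'.init = s),
          ∫ V, χk1 s' V * texpASucc avg χk T w s' V * f V ∂(fieldMeasure P (k + 1) G)
      = ∑ s' ∈ Finset.univ.filter (fun s' : Seq D (k + 1) => s'.init = s),
          ∫ V, (avgDensity avg V : ℝ) *
            ∫ U, (χk s'.init U * T s'.init U) * (w s' U V * (χk1 s' V * f V)) ∂(avgKernel avg V)
              ∂(fieldMeasure P (k + 1) G) :=
        Finset.sum_congr rfl fun s' _ => integral_congr_ae (ae_of_all _ (e s'))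
    _ = ∑ s' ∈ Finset.univ.filter (fun s' : Seq D (k + 1) => s'.init = s),
          ∫ U, (χk s'.init U * T s'.init U) * (w s' U (avg U) * (χk1 s' (avg U) * f (avg U))) ∂(fieldMeasure P k G) :=
        Finset.sum_congr rfl fun s' hs' => integral_transport_piece havg hac (hTs s' hs') (hb s') (hbC s')
    _ = ∫ U, ∑ s' ∈ Finset.univ.filter (fun s' : Seq D (k + 1) => s'.init = s),
          (χk s'.init U * T s'.init U) * (w s' U (avg U) * (χk1 s' (avg U) * f (avg U))) ∂(fieldMeasure P k G) :=
        (integral_finsetSum _ fun s' hs' => integrable_graph_piece havg (hTs s' hs') (hb s') (hbC s')).symm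
    _ = ∫ U, χk s U * T s U * f (avg U) ∂(fieldMeasure P k G) := by
        refine integral_congr_ae (ae_of_all _ fun U => ?_)
        have hu := hunit s U
        calc ∑ s' ∈ Finset.univ.filter (fun s' : Seq D (k + 1) => s'.init = s),
              (χk s'.init U * T s'.init U) * (w s' U (avg U) * (χk1 s' (avg U) * f (avg U)))
            = ∑ s' ∈ Finset.univ.filter (fun s' : Seq D (k + 1) => s'.init = s),
                (T s U * f (avg U)) * (χk s U * (χk1 s' (avg U) * w s' U (avg U))) := by
              refine Finset.sum_congr rfl fun s' hs' => ?_
              rw [(Finset.mem_filter.1 hs').2]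
              ring
          _ = χk s U * T s U * f (avg U) := by rw [← Finset.mul_sum, ← Finset.mul_sum, hu]; ring

open scoped Classical in
/-- ★ **THE T-STEP CONSERVES THE CLASS WEIGHT OF EVERY `init`-FIBRE** (`f ≡ 1` in `sum_fiber_integral_chi_texpASucc_mul`): under the unity law,
`Σ_{s′ : s′.init = s} ∫ χ_{k+1}(s′)·texpASucc(s′) = ∫ χ_k(s)·T(s)` — the mass that the length-`k` sequence `s` carries is exactly redistributed over its one-step
extensions. [cite: Balaban1988Convergent, (3.1) p.264, (3.25) p.270] -/
theorem sum_fiber_integral_chi_texpASucc (havg : Measurable avg) (hac : HaarAC avg) (χk T : Seq D k → Density P k G)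
    (χk1 : Seq D (k + 1) → Density P (k + 1) G) (w : Seq D (k + 1) → GaugeField P k G → GaugeField P (k + 1) G → ℝ)
    (s : Seq D k) (hT : Integrable (fun U => χk s U * T s U) (fieldMeasure P k G))
    (hw : ∀ s', Measurable (fun z : GaugeField P (k + 1) G × GaugeField P k G => w s' z.2 z.1))
    (hwb : ∀ s' U V', |w s' U V'| ≤ 1) (hχ : ∀ s', Measurable (χk1 s')) (hχb : ∀ s' V', |χk1 s' V'| ≤ 1)
    (hunit : IsStepUnity avg χk χk1 w) :
    ∑ s' ∈ Finset.univ.filter (fun s' : Seq D (k + 1) => s'.init = s),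
        ∫ V, χk1 s' V * texpASucc avg χk T w s' V ∂(fieldMeasure P (k + 1) G)
      = ∫ U, χk s U * T s U ∂(fieldMeasure P k G) := by
  have h := sum_fiber_integral_chi_texpASucc_mul havg hac χk T χk1 w s hT hw hwb hχ hχb hunit
    (f := fun _ => (1 : ℝ)) measurable_const ⟨1, fun _ => by simp⟩
  simp only [mul_one] at h
  exact h

end Generic

/-! ## §2 Of record: the T-step of record `tstepOfRecord` along `avOfRecord`, front factors `chiSeqOfRecord` -/

variable (F : T4Family) (N : ℕ) [NeZero N]

open scoped Classical in
/-- ★★ **ONE `init`-FIBRE OF THE T-STEP OF RECORD, AGAINST A TEST FUNCTION** (`k < K`; `sum_fiber_integral_chi_texpASucc_mul` at `avOfRecord`,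
`chiSeqOfRecord`, with `|χ_{k+1}| ≤ 1` by `abs_chiSeqOfRecord_le_one`): under the unity law of the step weights `w p g k`,
`Σ_{s′ : s′.init = s} ∫ χ_{k+1}(s′)·tstepOfRecord … T s′ · f = ∫ χ_k(s)·T(s)·(f ∘ avg)`. [cite: Balaban1988Convergent, (3.1) p.264, (3.25) p.270] -/
theorem sum_fiber_integral_chi_tstepOfRecord_mul (ν : Stage7Numerics) (M : ℕ) (w : StepWeightsOfRecord F N ν M) (p : B12.RunParams)
    (g : ℕ → ℝ) (k : ℕ) (hk : k < p.K) (T : SeqOfRecord F ν M g p.K k → Density (F.P p.K) k (SU N))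
    (s : SeqOfRecord F ν M g p.K k)
    (hT : Integrable (fun U => chiSeqOfRecord F N ν M g p.K k s U * T s U) (fieldMeasure (F.P p.K) k (SU N)))
    (hw : ∀ s', Measurable
      (fun z : GaugeField (F.P p.K) (k + 1) (SU N) × GaugeField (F.P p.K) k (SU N) => w p g k s' z.2 z.1))
    (hwb : ∀ s' U V', |w p g k s' U V'| ≤ 1) (hχ : ∀ s', Measurable (chiSeqOfRecord F N ν M g p.K (k + 1) s'))
    (hunit : IsStepUnity (avOfRecord F N p.K k).avg (chiSeqOfRecord F N ν M g p.K k)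
      (chiSeqOfRecord F N ν M g p.K (k + 1)) (w p g k))
    {f : GaugeField (F.P p.K) (k + 1) (SU N) → ℝ} (hf : Measurable f) (hfC : ∃ C, ∀ V, |f V| ≤ C) :
    ∑ s' ∈ Finset.univ.filter (fun s' : SeqOfRecord F ν M g p.K (k + 1) => s'.init = s),
        ∫ V, chiSeqOfRecord F N ν M g p.K (k + 1) s' V * tstepOfRecord F N ν M w p g k T s' V * f V
          ∂(fieldMeasure (F.P p.K) (k + 1) (SU N))
      = ∫ U, chiSeqOfRecord F N ν M g p.K k s U * T s U * f ((avOfRecord F N p.K k).avg U) ∂(fieldMeasure (F.P p.K) k (SU N)) :=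
  sum_fiber_integral_chi_texpASucc_mul (avOfRecord_measurable F N p.K k) (avOfRecord_haarAC F N p.K k hk) _ T _ _ s hT hw hwb hχ
    (fun s' V' => abs_chiSeqOfRecord_le_one F N ν M g p.K (k + 1) s' V') hunit hf hfC

open scoped Classical in
/-- ★★ **THE T-STEP OF RECORD CONSERVES THE CLASS WEIGHT OF EVERY `init`-FIBRE** (`k < K`): under the unity law of the step weights,
`Σ_{s′ : s′.init = s} ∫ χ_{k+1}(s′)·tstepOfRecord … T s′ = ∫ χ_k(s)·T(s)` — the T-half of the class-wise telescoping of the (2.18) class weights that the N20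
lineage's tower sockets display (`Summit…BlocksFreshTowerFaces`, hTA ∕ hTB); the 𝐑-half is the slot operation of record's. [cite: Balaban1988Convergent, (3.1) p.264, (3.25) p.270] -/
theorem sum_fiber_integral_chi_tstepOfRecord (ν : Stage7Numerics) (M : ℕ) (w : StepWeightsOfRecord F N ν M) (p : B12.RunParams)
    (g : ℕ → ℝ) (k : ℕ) (hk : k < p.K) (T : SeqOfRecord F ν M g p.K k → Density (F.P p.K) k (SU N))
    (s : SeqOfRecord F ν M g p.K k)
    (hT : Integrable (fun U => chiSeqOfRecord F N ν M g p.K k s U * T s U) (fieldMeasure (F.P p.K) k (SU N)))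
    (hw : ∀ s', Measurable
      (fun z : GaugeField (F.P p.K) (k + 1) (SU N) × GaugeField (F.P p.K) k (SU N) => w p g k s' z.2 z.1))
    (hwb : ∀ s' U V', |w p g k s' U V'| ≤ 1) (hχ : ∀ s', Measurable (chiSeqOfRecord F N ν M g p.K (k + 1) s'))
    (hunit : IsStepUnity (avOfRecord F N p.K k).avg (chiSeqOfRecord F N ν M g p.K k)
      (chiSeqOfRecord F N ν M g p.K (k + 1)) (w p g k)) :
    ∑ s' ∈ Finset.univ.filter (fun s' : SeqOfRecord F ν M g p.K (k + 1) => s'.init = s),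
        ∫ V, chiSeqOfRecord F N ν M g p.K (k + 1) s' V * tstepOfRecord F N ν M w p g k T s' V ∂(fieldMeasure (F.P p.K) (k + 1) (SU N))
      = ∫ U, chiSeqOfRecord F N ν M g p.K k s U * T s U ∂(fieldMeasure (F.P p.K) k (SU N)) :=
  sum_fiber_integral_chi_texpASucc (avOfRecord_measurable F N p.K k) (avOfRecord_haarAC F N p.K k hk) _ T _ _ s hT hw hwb hχ
    (fun s' V' => abs_chiSeqOfRecord_le_one F N ν M g p.K (k + 1) s' V') hunit

end Literature.MathematicalPhysics.QuantumFieldTheory.Balaban1983to89.Node00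

end
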